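import Mathlib
import Literature.NumberTheory.LFunctions.Zhang2022.Section8XiZeroMajorant
import Literature.NumberTheory.LFunctions.Zhang2022.Section8PerronSteps
import Literature.NumberTheory.LFunctions.Zhang2022.TypedSection15B
import Literature.NumberTheory.LFunctions.Zhang2022.AppendixALemma83Local
import Literature.NumberTheory.LFunctions.Zhang2022.Section11Deductions
import HarnessLib

/-!
# Zhang (2022) §7 p. 33 / App. A p. 101: `ξ₀ⱼ(n;d,r)` is a multiplicative function of `n` — kernel-checked

Topic `Literature/NumberTheory/LFunctions/Zhang2022` (Landau–Siegel audit tree; verdict-neutral).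
Y. Zhang, *Discrete mean estimates and the Landau–Siegel zero*, arXiv:2211.02515v1 (2022)
[Zhang2022LandauSiegel] — **an unrefereed manuscript under adjudication; nothing here asserts or denies
its Theorems 1–2.** ZHANG-L discharge lane (WP09), input of the Euler-product sentence of App. A §A.u004
("Thus, for `σ > 1`, `𝒰_j(d,h;s) = ∏_q 𝔱_j(d,h,s;q)`", tex L4982–4986, typed as
`Typed.AppendixA1.StepA_u004_read`), which the manuscript obtains from the (unstated, unproved)
multiplicativity in `m` of `λ̃(m,dh;1−β_j)ξ_j(m;d,h) = ξ₀ⱼ(m;d,h)` (§7 p. 33).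

This file PROVES that multiplicativity for the banked objects of `SkeletonMeanValue` (theorems only, no
new definitions, no facts; valid for every `D`, `c′`, `j`, `d ≥ 1`, `r ≥ 1`):

* `summable_norm_kappaTilde_term` — the defining series of `κ̃(d;m,s)` converges absolutely for `Re s = 1`
  (dominated by `Σ_{h∈𝔫(d)} |κ(dh)|/h = Kmaj d`, the Euler box of `Section8XiZeroMajorant`);
* `kappaTilde_mul_of_coprime` — **`κ̃(d₁d₂;m,s) = κ̃(d₁;m,s)κ̃(d₂;m,s)`** for `(d₁,d₂) = 1`, `Re s = 1`
  (the bijection `𝔫(d₁) × 𝔫(d₂) → 𝔫(d₁d₂)`, `(a,b) ↦ ab`, and the multiplicativity of `κ`);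
* `kappaTilde_mul_right_eq` — locality `κ̃(d; mk, s) = κ̃(d; m, s)` when `(d,k) = 1`;
* `lamTildeZero_mul_of_coprime` — `λ̃₀ⱼ(n₁n₂,M) = λ̃₀ⱼ(n₁,M)λ̃₀ⱼ(n₂,M)` for coprime `n₁, n₂`;
* `xiInner_mul_of_coprime` — the inner sum `Σ_{n=mk,(k,r)=1} κ̃₀ⱼ(m;drk)μ(k)k^{1−β_j}/φ(k)` of `ξ₀ⱼ`
  is multiplicative in `n`; hence **`xiZero_mul_of_coprime`: `ξ₀ⱼ(n₁n₂;d,r) = ξ₀ⱼ(n₁;d,r)ξ₀ⱼ(n₂;d,r)`**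
  and `xiZero_apply_one : ξ₀ⱼ(1;d,r) = 1`.

The architecture is the §15 twin `TypedSection15B` (`kappaTilde1_mul_of_coprime`, `inline15_xi1Mult_holds`
for `κ̃₁/ξ₁`), transported to `κ̃(d;m,s)` at `Re s = 1` and to §7's `ξ₀ⱼ`.

## References

* Y. Zhang, arXiv:2211.02515v1 (2022), §7 p. 33 (tex L1789–L1797), App. A p. 101 (tex L4982–4986).
  [cite: Zhang2022LandauSiegel, §7 p.33; App. A p.101]
-/

noncomputable section

open Complex Real Finset

namespace Literature.NumberTheory.LFunctions.Zhang2022.Lemma83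

open Literature.NumberTheory.LFunctions.Zhang2022
open Literature.NumberTheory.LFunctions.Zhang2022.Skeleton
open Literature.NumberTheory.LFunctions.Zhang2022.Typed.Section15B
  (coprime_of_mem_nset_of_mem_nset coprime_of_mem_nset_of_coprime self_mem_nset mul_mem_nset_mul
    self_mul_mem_nset exists_mem_nset_mul_of_mem_nset_mul smooth_mul_rough_unique eq_one_of_mem_nset_one)

variable (c' : ℝ) (D : ℕ)

/-! ## The series `κ̃(d;m,s)` converges absolutely for `Re s = 1` -/

open scoped Classical in
/-- **Absolute convergence of `κ̃(d;m,s) = Σ_{h∈𝔫(d),(h,m)=1} κ(dh)h^{−s}` for `Re s = 1`** (`d ≥ 1`):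
the terms are dominated by `𝟙_{𝔫(d)}(h)·|κ(dh)|/h`, whose sum is the Euler box
`∏_{q^v ∥ d} Σ_a |κ(q^{v+a})|q^{−a} = Kmaj d` (`Section8XiZeroMajorant`).
[cite: Zhang2022LandauSiegel, §7 p.33] -/
theorem summable_norm_kappaTilde_term {d : ℕ} (hd : d ≠ 0) (m : ℕ) {s : ℂ} (hs : s.re = 1) :
    Summable (fun h : ℕ => ‖(if h ∈ nset d ∧ Nat.Coprime h m then
      kappaZ c' D (d * h) / (h : ℂ) ^ s else 0 : ℂ)‖) := by
  set P := d.primeFactors with hP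
  have hPprime : ∀ q ∈ P, q.Prime := fun q hq => Nat.prime_of_mem_primeFactors hq
  set φ : ℕ → ℕ → ℝ := fun q a =>
    ‖kappaZ c' D (q ^ (d.factorization q + a))‖ / (q : ℝ) ^ a with hφ
  have hφ0 : ∀ q a, 0 ≤ φ q a := fun q a => div_nonneg (norm_nonneg _) (by positivity)
  have hφs : ∀ q, q.Prime → Summable (φ q) := fun q hq => XiZeroMajorant.summable_locK c' D hq _
  obtain ⟨-, hHas⟩ := XiZeroMajorant.summable_hasSum_factoredNumbers_localProd hφ0 hφs P hPprime
  set G : ℕ → ℝ := (nset d).indicator fun h => ‖kappaZ c' D (d * h)‖ / h with hG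
  have hGsum : HasSum G (∏ q ∈ P, ∑' a, φ q a) := by
    rw [hG, XiZeroMajorant.nset_eq_factoredNumbers hd, ← hasSum_subtype_iff_indicator]
    convert hHas using 1
    funext x
    exact XiZeroMajorant.norm_kappa_mul_div_eq_prod c' D hd x.2
  refine Summable.of_nonneg_of_le (fun _ => norm_nonneg _) (fun h => ?_) hGsum.summable
  by_cases hmem : h ∈ nset d
  · have hpos : 0 < h := hmem.1
    rw [hG, Set.indicator_of_mem hmem]
    by_cases hcop : Nat.Coprime h m
    · rw [if_pos ⟨hmem, hcop⟩, norm_div, Complex.norm_natCast_cpow_of_pos hpos, hs, Real.rpow_one]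
    · rw [if_neg (fun h' => hcop h'.2), norm_zero]
      exact div_nonneg (norm_nonneg _) (Nat.cast_nonneg _)
  · rw [hG, Set.indicator_of_notMem hmem, if_neg (fun h' => hmem h'.1), norm_zero]

/-! ## `κ̃(d₁d₂;m,s) = κ̃(d₁;m,s)κ̃(d₂;m,s)` for coprime `d₁, d₂` -/

open scoped Classical in
/-- The summand of `κ̃(d₁d₂;m,s)` at `h = ab` (`a ∈ 𝔫(d₁)`, `b ∈ 𝔫(d₂)`, `(d₁,d₂) = 1`) is the product of
the summands of `κ̃(d₁;m,s)` at `a` and of `κ̃(d₂;m,s)` at `b` (`κ` multiplicative, `(d₁a, d₂b) = 1`).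
[cite: Zhang2022LandauSiegel, §7 p.33] -/
theorem kappaTilde_term_mul {d₁ d₂ : ℕ} (hd₁ : d₁ ≠ 0) (hd₂ : d₂ ≠ 0) (hd : Nat.Coprime d₁ d₂)
    (m : ℕ) (s : ℂ) {a b : ℕ} (ha : a ∈ nset d₁) (hb : b ∈ nset d₂) :
    (if a * b ∈ nset (d₁ * d₂) ∧ Nat.Coprime (a * b) m then
        kappaZ c' D (d₁ * d₂ * (a * b)) / ((a * b : ℕ) : ℂ) ^ s else 0) =
      (if a ∈ nset d₁ ∧ Nat.Coprime a m then kappaZ c' D (d₁ * a) / (a : ℂ) ^ s else 0) *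
        (if b ∈ nset d₂ ∧ Nat.Coprime b m then kappaZ c' D (d₂ * b) / (b : ℂ) ^ s else 0) := by
  have hab : a * b ∈ nset (d₁ * d₂) := mul_mem_nset_mul ha hb
  by_cases hca : Nat.Coprime a m
  · by_cases hcb : Nat.Coprime b m
    · rw [if_pos ⟨hab, Nat.Coprime.mul_left hca hcb⟩, if_pos ⟨ha, hca⟩, if_pos ⟨hb, hcb⟩]
      have hcop : Nat.Coprime (d₁ * a) (d₂ * b) :=
        coprime_of_mem_nset_of_mem_nset hd (self_mul_mem_nset hd₁ ha) (self_mul_mem_nset hd₂ hb)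
      have e : d₁ * d₂ * (a * b) = (d₁ * a) * (d₂ * b) := by ring
      have e2 : kappaZ c' D ((d₁ * a) * (d₂ * b)) = kappaZ c' D (d₁ * a) * kappaZ c' D (d₂ * b) :=
        (MeanSquareMajorant.isMultiplicative_kappa _ _ _).map_mul_of_coprime hcop
      rw [e, e2, Nat.cast_mul, Complex.natCast_mul_natCast_cpow, div_mul_div_comm]
    · rw [if_neg (fun h => hcb (Nat.Coprime.coprime_mul_left h.2)), if_pos ⟨ha, hca⟩,
        if_neg (fun h => hcb h.2), mul_zero]
  · rw [if_neg (fun h => hca (Nat.Coprime.coprime_mul_right h.2)), if_neg (fun h => hca h.2),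
      zero_mul]

open scoped Classical in
/-- **`κ̃(d₁d₂;m,s) = κ̃(d₁;m,s)·κ̃(d₂;m,s)` for `(d₁,d₂) = 1` and `Re s = 1`** (`d₁, d₂ ≥ 1`, any `m`):
the map `(a,b) ↦ ab`, `𝔫(d₁) × 𝔫(d₂) → 𝔫(d₁d₂)`, is a bijection, `κ` is multiplicative, and both series
converge absolutely (`summable_norm_kappaTilde_term`). The §7 twin of `TypedSection15B.kappaTilde1_mul_of_coprime`.
[cite: Zhang2022LandauSiegel, §7 p.33] -/
theorem kappaTilde_mul_of_coprime {d₁ d₂ : ℕ} (hd₁ : d₁ ≠ 0) (hd₂ : d₂ ≠ 0)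
    (hd : Nat.Coprime d₁ d₂) (m : ℕ) {s : ℂ} (hs : s.re = 1) :
    kappaTilde c' D (d₁ * d₂) m s = kappaTilde c' D d₁ m s * kappaTilde c' D d₂ m s := by
  unfold kappaTilde
  rw [tsum_mul_tsum_of_summable_norm (summable_norm_kappaTilde_term c' D hd₁ m hs)
    (summable_norm_kappaTilde_term c' D hd₂ m hs)]
  symm
  set T₁ : ℕ → ℂ := fun h => if h ∈ nset d₁ ∧ Nat.Coprime h m then
      kappaZ c' D (d₁ * h) / (h : ℂ) ^ s else 0 with hT₁
  set T₂ : ℕ → ℂ := fun h => if h ∈ nset d₂ ∧ Nat.Coprime h m then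
      kappaZ c' D (d₂ * h) / (h : ℂ) ^ s else 0 with hT₂
  set T : ℕ → ℂ := fun h => if h ∈ nset (d₁ * d₂) ∧ Nat.Coprime h m then
      kappaZ c' D (d₁ * d₂ * h) / (h : ℂ) ^ s else 0 with hT
  have hne₁ : ∀ {a}, T₁ a ≠ 0 → a ∈ nset d₁ ∧ Nat.Coprime a m := fun h => by
    by_contra hc; exact h (by simp only [hT₁]; rw [if_neg hc])
  have hne₂ : ∀ {b}, T₂ b ≠ 0 → b ∈ nset d₂ ∧ Nat.Coprime b m := fun h => by
    by_contra hc; exact h (by simp only [hT₂]; rw [if_neg hc])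
  have hmulT : ∀ {a b}, a ∈ nset d₁ → b ∈ nset d₂ → T (a * b) = T₁ a * T₂ b := by
    intro a b ha hb
    simp only [hT, hT₁, hT₂]
    have := kappaTilde_term_mul c' D hd₁ hd₂ hd m s ha hb
    push_cast at this ⊢
    exact this
  show ∑' z : ℕ × ℕ, T₁ z.1 * T₂ z.2 = ∑' h, T h
  symm
  refine tsum_eq_tsum_of_ne_zero_bij (fun z => z.1.1 * z.1.2) ?_ ?_ ?_
  · rintro ⟨⟨a, b⟩, hz⟩ ⟨⟨a', b'⟩, hz'⟩ he
    simp only [Function.mem_support, ne_eq, mul_eq_zero, not_or] at hz hz'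
    simp only at he
    have ha := (hne₁ hz.1).1
    have hb := (hne₂ hz.2).1
    have ha' := (hne₁ hz'.1).1
    have hb' := (hne₂ hz'.2).1
    obtain ⟨h1, h2⟩ := smooth_mul_rough_unique (K := d₁) he ha
      (coprime_of_mem_nset_of_mem_nset hd.symm hb (self_mem_nset hd₁)) ha'
      (coprime_of_mem_nset_of_mem_nset hd.symm hb' (self_mem_nset hd₁))
    subst h1; subst h2; rfl
  · intro h hh
    rw [Function.mem_support] at hh
    have hh' : h ∈ nset (d₁ * d₂) := by
      by_contra hc
      exact hh (by simp only [hT]; rw [if_neg (fun h2 => hc h2.1)])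
    obtain ⟨a, b, rfl, ha, hb⟩ := exists_mem_nset_mul_of_mem_nset_mul hh'
    have hz : T₁ a * T₂ b ≠ 0 := by rw [← hmulT ha hb]; exact hh
    exact ⟨⟨(a, b), by simpa [Function.mem_support] using hz⟩, rfl⟩
  · rintro ⟨⟨a, b⟩, hz⟩
    simp only [Function.mem_support, ne_eq, mul_eq_zero, not_or] at hz
    simp only
    exact hmulT (hne₁ hz.1).1 (hne₂ hz.2).1

/-! ## Locality of `κ̃` in the coprimality slot -/

open scoped Classical in
/-- **`κ̃(d; mk, s) = κ̃(d; m, s)` when `(d,k) = 1`**: an `h ∈ 𝔫(d)` is automatically coprime to `k`.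
[cite: Zhang2022LandauSiegel, §7 p.33] -/
theorem kappaTilde_mul_right_eq {d k : ℕ} (hk : Nat.Coprime d k) (m : ℕ) (s : ℂ) :
    kappaTilde c' D d (m * k) s = kappaTilde c' D d m s := by
  unfold kappaTilde
  refine tsum_congr fun h => ?_
  have hiff : (h ∈ nset d ∧ Nat.Coprime h (m * k)) ↔ (h ∈ nset d ∧ Nat.Coprime h m) := by
    constructor
    · rintro ⟨hn, hc⟩
      exact ⟨hn, Nat.Coprime.coprime_mul_right_right hc⟩
    · rintro ⟨hn, hc⟩
      exact ⟨hn, Nat.Coprime.mul_right hc (coprime_of_mem_nset_of_coprime hn hk.symm)⟩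
  by_cases h1 : h ∈ nset d ∧ Nat.Coprime h (m * k)
  · rw [if_pos h1, if_pos (hiff.mp h1)]
  · rw [if_neg h1, if_neg (fun h2 => h1 (hiff.mpr h2))]

/-- `κ̃(1; m, s) = 1` for every `m` (`𝔫(1) = {1}`, `κ(1) = 1`). [cite: Zhang2022LandauSiegel, §7 p.33] -/
theorem kappaTilde_one_left (m : ℕ) (s : ℂ) : kappaTilde c' D 1 m s = 1 := by
  classical
  unfold kappaTilde
  rw [tsum_eq_single 1]
  · rw [if_pos ⟨mem_nset_one_iff.mpr rfl, Nat.coprime_one_left m⟩, mul_one, Nat.cast_one,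
      Complex.one_cpow, div_one, kappaZ_one]
  · intro h hh
    rw [if_neg]
    rintro ⟨hn, -⟩
    exact hh (mem_nset_one_iff.mp hn)

/-! ## `λ̃₀ⱼ(n,M)` is multiplicative in `n` -/

/-- **`λ̃₀ⱼ(n₁n₂, M) = λ̃₀ⱼ(n₁, M)·λ̃₀ⱼ(n₂, M)`** for coprime `n₁, n₂` (the prime factors of `n₁n₂` are the
disjoint union of those of `n₁` and `n₂`). [cite: Zhang2022LandauSiegel, §7 p.33] -/
theorem lamTildeZero_mul_of_coprime (j M : ℕ) {n₁ n₂ : ℕ} (hn : Nat.Coprime n₁ n₂) :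
    lamTildeZero c' D j (n₁ * n₂) M = lamTildeZero c' D j n₁ M * lamTildeZero c' D j n₂ M := by
  unfold lamTildeZero
  rw [Nat.Coprime.primeFactors_mul hn, Finset.filter_union,
    Finset.prod_union (Finset.disjoint_filter_filter hn.disjoint_primeFactors)]

/-! ## The inner sum of `ξ₀ⱼ` is multiplicative -/

/-- The divisor pairs of `mn`, `(m,n) = 1`, are the products of the divisor pairs of `m` and of `n`
(the bijection `((i,j),(k,l)) ↦ (ik, jl)`; proved privately in `TypedSection15B`/`TypedSection16B` and as
`…EllipticCurves.ModularForms.UpperHecke.sum_divisorsAntidiagonal_mul_of_coprime` — re-proved here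
privately to keep the import cone minimal). [folklore] -/
private theorem sum_divisorsAntidiagonal_mul_of_coprime' {M : Type*} [AddCommMonoid M] {m n : ℕ}
    (hmn : m.Coprime n) (f : ℕ × ℕ → M) :
    ∑ w ∈ (m * n).divisorsAntidiagonal, f w =
      ∑ x ∈ m.divisorsAntidiagonal, ∑ y ∈ n.divisorsAntidiagonal, f (x.1 * y.1, x.2 * y.2) := by
  rw [← Finset.sum_product']
  symm
  apply Finset.sum_nbij fun ((i, j), k, l) ↦ (i * k, j * l)
  · rintro ⟨⟨a1, a2⟩, ⟨b1, b2⟩⟩ h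
    simp only [Nat.mem_divisorsAntidiagonal, Ne, Finset.mem_product] at h
    rcases h with ⟨⟨rfl, ha⟩, ⟨rfl, hb⟩⟩
    simp only [Nat.mem_divisorsAntidiagonal, mul_eq_zero, Ne]
    constructor
    · ring
    rw [mul_eq_zero] at *
    exact not_or_intro ha hb
  · simp only [Set.InjOn, Finset.mem_coe, Nat.mem_divisorsAntidiagonal, Finset.mem_product, Prod.mk_inj]
    rintro ⟨⟨a1, a2⟩, ⟨b1, b2⟩⟩ ⟨⟨rfl, ha⟩, ⟨rfl, hb⟩⟩ ⟨⟨c1, c2⟩, ⟨d1, d2⟩⟩ hcd h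
    have cop := hmn
    ext
    · trans Nat.gcd (a1 * a2) (a1 * b1)
      · rw [Nat.gcd_mul_left, cop.coprime_mul_left.coprime_mul_right_right.gcd_eq_one, mul_one]
      · rw [← hcd.1.1, ← hcd.2.1] at cop
        rw [← hcd.1.1, h.1, Nat.gcd_mul_left,
          cop.coprime_mul_left.coprime_mul_right_right.gcd_eq_one, mul_one]
    · trans Nat.gcd (a1 * a2) (a2 * b2)
      · rw [mul_comm, Nat.gcd_mul_left, cop.coprime_mul_right.coprime_mul_left_right.gcd_eq_one,
          mul_one]
      · rw [← hcd.1.1, ← hcd.2.1] at cop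
        rw [← hcd.1.1, h.2, mul_comm, Nat.gcd_mul_left,
          cop.coprime_mul_right.coprime_mul_left_right.gcd_eq_one, mul_one]
    · trans Nat.gcd (b1 * b2) (a1 * b1)
      · rw [mul_comm, Nat.gcd_mul_right,
          cop.coprime_mul_right.coprime_mul_left_right.symm.gcd_eq_one, one_mul]
      · rw [← hcd.1.1, ← hcd.2.1] at cop
        rw [← hcd.2.1, h.1, mul_comm c1 d1, Nat.gcd_mul_left,
          cop.coprime_mul_right.coprime_mul_left_right.symm.gcd_eq_one, mul_one]
    · trans Nat.gcd (b1 * b2) (a2 * b2)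
      · rw [Nat.gcd_mul_right, cop.coprime_mul_left.coprime_mul_right_right.symm.gcd_eq_one, one_mul]
      · rw [← hcd.1.1, ← hcd.2.1] at cop
        rw [← hcd.2.1, h.2, Nat.gcd_mul_right,
          cop.coprime_mul_left.coprime_mul_right_right.symm.gcd_eq_one, one_mul]
  · simp only [Set.SurjOn, Set.subset_def, Finset.mem_coe, Nat.mem_divisorsAntidiagonal,
      Finset.mem_product, Set.mem_image]
    rintro ⟨b1, b2⟩ h
    use ((b1.gcd m, b2.gcd m), (b1.gcd n, b2.gcd n))
    rw [← hmn.gcd_mul _, ← hmn.gcd_mul _, ← h.1, Nat.gcd_mul_gcd_of_coprime_of_mul_eq_mul hmn h.1,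
      Nat.gcd_mul_gcd_of_coprime_of_mul_eq_mul hmn.symm _]
    · rw [Ne, mul_eq_zero, not_or] at h
      simp [h.2.1, h.2.2]
    rw [mul_comm n m, h.1]
  · rintro ⟨⟨a1, a2⟩, ⟨b1, b2⟩⟩ _
    rfl

/-- The inner sum of `ξ₀ⱼ(n;d,r)` as a sum over the divisor pairs `(k, m)` of `n`.
[cite: Zhang2022LandauSiegel, §7 p.33] -/
theorem xiInner_eq_sum_divisorsAntidiagonal (j n d r : ℕ) :
    (∑ k ∈ n.divisors.filter (fun k => Nat.Coprime k r),
      kappaTildeZero c' D j (n / k) (d * r * k) * (ArithmeticFunction.moebius k : ℂ) *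
        (k : ℂ) ^ (1 - betaJ c' D j) / (Nat.totient k : ℂ)) =
    ∑ x ∈ n.divisorsAntidiagonal,
      if Nat.Coprime x.1 r then
        kappaTildeZero c' D j x.2 (d * r * x.1) * (ArithmeticFunction.moebius x.1 : ℂ) *
          (x.1 : ℂ) ^ (1 - betaJ c' D j) / (Nat.totient x.1 : ℂ)
      else 0 := by
  rw [Finset.sum_filter, ← Nat.sum_divisorsAntidiagonal fun k m =>
    if Nat.Coprime k r then
      kappaTildeZero c' D j m (d * r * k) * (ArithmeticFunction.moebius k : ℂ) *
        (k : ℂ) ^ (1 - betaJ c' D j) / (Nat.totient k : ℂ) else 0]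

/-- `Re(1 − β_j) = 1`. [cite: Zhang2022LandauSiegel, §2 (2.13)] -/
theorem one_sub_betaJ_re (j : ℕ) : (1 - betaJ c' D j).re = 1 := by
  rw [Complex.sub_re, Complex.one_re, Section8PerronSteps.betaJ_re, sub_zero]

/-- **The inner sum `Ξ(n;d,r) = Σ_{n=mk,(k,r)=1} κ̃₀ⱼ(m;drk)μ(k)k^{1−β_j}/φ(k)` of `ξ₀ⱼ(n;d,r)` is
multiplicative in `n`** (`d, r ≥ 1`): for `n = n₁n₂` coprime the divisor pairs of `n` are the products of
those of `n₁`, `n₂`; `μ(k)k^{1−β_j}/φ(k)` is multiplicative; and `κ̃₀ⱼ(m₁m₂; drk₁k₂) =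
κ̃₀ⱼ(m₁; drk₁)κ̃₀ⱼ(m₂; drk₂)` by `kappaTilde_mul_of_coprime` (at `s = 1 − β_j`, `Re s = 1`) and the
locality `kappaTilde_mul_right_eq`. The §7 twin of `TypedSection15B.inline15_xi1Mult_holds`.
[cite: Zhang2022LandauSiegel, §7 p.33; App. A p.101] -/
theorem xiInner_mul_of_coprime (j : ℕ) {d r : ℕ} (hd : d ≠ 0) (hr : r ≠ 0) {n₁ n₂ : ℕ}
    (hn : Nat.Coprime n₁ n₂) :
    (∑ k ∈ (n₁ * n₂).divisors.filter (fun k => Nat.Coprime k r),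
      kappaTildeZero c' D j (n₁ * n₂ / k) (d * r * k) * (ArithmeticFunction.moebius k : ℂ) *
        (k : ℂ) ^ (1 - betaJ c' D j) / (Nat.totient k : ℂ)) =
    (∑ k ∈ n₁.divisors.filter (fun k => Nat.Coprime k r),
      kappaTildeZero c' D j (n₁ / k) (d * r * k) * (ArithmeticFunction.moebius k : ℂ) *
        (k : ℂ) ^ (1 - betaJ c' D j) / (Nat.totient k : ℂ)) *
    (∑ k ∈ n₂.divisors.filter (fun k => Nat.Coprime k r),
      kappaTildeZero c' D j (n₂ / k) (d * r * k) * (ArithmeticFunction.moebius k : ℂ) *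
        (k : ℂ) ^ (1 - betaJ c' D j) / (Nat.totient k : ℂ)) := by
  classical
  rcases Nat.eq_zero_or_pos n₁ with hm0 | hm0
  · subst hm0; simp [xiInner_eq_sum_divisorsAntidiagonal]
  rcases Nat.eq_zero_or_pos n₂ with hn0 | hn0
  · subst hn0; simp [xiInner_eq_sum_divisorsAntidiagonal]
  have hdr : d * r ≠ 0 := mul_ne_zero hd hr
  rw [xiInner_eq_sum_divisorsAntidiagonal, xiInner_eq_sum_divisorsAntidiagonal,
    xiInner_eq_sum_divisorsAntidiagonal, sum_divisorsAntidiagonal_mul_of_coprime' hn,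
    Finset.sum_mul_sum]
  refine Finset.sum_congr rfl fun x hx => Finset.sum_congr rfl fun y hy => ?_
  have hx' := Nat.mem_divisorsAntidiagonal.mp hx
  have hy' := Nat.mem_divisorsAntidiagonal.mp hy
  have hx1 : x.1 ≠ 0 := fun h0 => hx'.2 (by rw [← hx'.1, h0, zero_mul])
  have hx2 : x.2 ≠ 0 := fun h0 => hx'.2 (by rw [← hx'.1, h0, mul_zero])
  have hy1 : y.1 ≠ 0 := fun h0 => hy'.2 (by rw [← hy'.1, h0, zero_mul])
  have hy2 : y.2 ≠ 0 := fun h0 => hy'.2 (by rw [← hy'.1, h0, mul_zero])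
  have hcop : Nat.Coprime (x.1 * x.2) (y.1 * y.2) := by rw [hx'.1, hy'.1]; exact hn
  have h11 : Nat.Coprime x.1 y.1 :=
    Nat.Coprime.coprime_dvd_left (Dvd.intro _ rfl) (Nat.Coprime.coprime_dvd_right (Dvd.intro _ rfl) hcop)
  have h22 : Nat.Coprime x.2 y.2 :=
    Nat.Coprime.coprime_dvd_left (Dvd.intro_left _ rfl)
      (Nat.Coprime.coprime_dvd_right (Dvd.intro_left _ rfl) hcop)
  have h21 : Nat.Coprime x.2 y.1 :=
    Nat.Coprime.coprime_dvd_left (Dvd.intro_left _ rfl)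
      (Nat.Coprime.coprime_dvd_right (Dvd.intro _ rfl) hcop)
  have h12 : Nat.Coprime x.1 y.2 :=
    Nat.Coprime.coprime_dvd_left (Dvd.intro _ rfl)
      (Nat.Coprime.coprime_dvd_right (Dvd.intro_left _ rfl) hcop)
  simp only
  by_cases hcx : Nat.Coprime x.1 r
  · by_cases hcy : Nat.Coprime y.1 r
    · rw [if_pos (Nat.Coprime.mul_left hcx hcy), if_pos hcx, if_pos hcy]
      -- the `κ̃₀ⱼ` factor
      have hK : kappaTildeZero c' D j (x.2 * y.2) (d * r * (x.1 * y.1)) =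
          kappaTildeZero c' D j x.2 (d * r * x.1) * kappaTildeZero c' D j y.2 (d * r * y.1) := by
        unfold kappaTildeZero
        rw [kappaTilde_mul_of_coprime c' D hx2 hy2 h22 _ (one_sub_betaJ_re c' D j), ← mul_assoc,
          kappaTilde_mul_right_eq c' D h21,
          show d * r * x.1 * y.1 = d * r * y.1 * x.1 by ring, kappaTilde_mul_right_eq c' D h12.symm]
      -- the arithmetic factor `μ(k)k^{1−β_j}/φ(k)`
      have hμ : (ArithmeticFunction.moebius (x.1 * y.1) : ℂ) =
          (ArithmeticFunction.moebius x.1 : ℂ) * (ArithmeticFunction.moebius y.1 : ℂ) := by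
        rw [ArithmeticFunction.isMultiplicative_moebius.map_mul_of_coprime h11]
        push_cast
        ring
      have hφ : (Nat.totient (x.1 * y.1) : ℂ) = (Nat.totient x.1 : ℂ) * (Nat.totient y.1 : ℂ) := by
        rw [Nat.totient_mul h11]; push_cast; ring
      have hpow : ((x.1 * y.1 : ℕ) : ℂ) ^ (1 - betaJ c' D j) =
          (x.1 : ℂ) ^ (1 - betaJ c' D j) * (y.1 : ℂ) ^ (1 - betaJ c' D j) := by
        rw [Nat.cast_mul, Complex.natCast_mul_natCast_cpow]
      rw [hK, hμ, hφ]
      push_cast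
      rw [Complex.natCast_mul_natCast_cpow]
      simp only [div_eq_mul_inv, mul_inv]
      ring
    · rw [if_neg (fun h => hcy (Nat.Coprime.coprime_mul_left h)), if_pos hcx, if_neg hcy, mul_zero]
  · rw [if_neg (fun h => hcx (Nat.Coprime.coprime_mul_right h)), if_neg hcx, zero_mul]

/-! ## `ξ₀ⱼ(n;d,r)` is multiplicative in `n` -/

/-- **`ξ₀ⱼ(n₁n₂;d,r) = ξ₀ⱼ(n₁;d,r)·ξ₀ⱼ(n₂;d,r)` for coprime `n₁, n₂`** (`d, r ≥ 1`; the manuscript's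
"`λ̃(m,h,d;1−β_j)ξ_j(m;d,h)` is multiplicative", implicit in App. A p. 101 tex L4982–4986):
`ξ₀ⱼ = λ̃₀ⱼ · Ξ` with both factors multiplicative (`lamTildeZero_mul_of_coprime`, `xiInner_mul_of_coprime`).
[cite: Zhang2022LandauSiegel, §7 p.33; App. A p.101] -/
theorem xiZero_mul_of_coprime (j : ℕ) {d r : ℕ} (hd : d ≠ 0) (hr : r ≠ 0) {n₁ n₂ : ℕ}
    (hn : Nat.Coprime n₁ n₂) :
    xiZero c' D j (n₁ * n₂) d r = xiZero c' D j n₁ d r * xiZero c' D j n₂ d r := by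
  unfold xiZero
  rw [lamTildeZero_mul_of_coprime c' D j (d * r) hn, xiInner_mul_of_coprime c' D j hd hr hn]
  ring

/-- **`ξ₀ⱼ(1;d,r) = 1`** (`λ̃₀ⱼ(1,dr) = 1`, the only divisor pair is `(1,1)`, `κ̃₀ⱼ(1;dr) = κ(1) = 1`,
`μ(1) = φ(1) = 1`). [cite: Zhang2022LandauSiegel, §7 p.33] -/
theorem xiZero_apply_one (j d r : ℕ) : xiZero c' D j 1 d r = 1 := by
  unfold xiZero
  rw [Section11Deductions.lamTildeZero_one, Nat.divisors_one, Finset.filter_singleton,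
    if_pos (Nat.coprime_one_left r), Finset.sum_singleton, Nat.div_one, kappaTildeZero,
    kappaTilde_one_left, ArithmeticFunction.moebius_apply_one, Nat.totient_one]
  simp

/-- `ξ₀ⱼ(0;d,r) = 0` (junk value of the banked object: `0` has no divisors; the manuscript's `ξ₀ⱼ` is
only evaluated at `n ≥ 1`). [cite: Zhang2022LandauSiegel, §7 p.33] -/
theorem xiZero_apply_zero (j d r : ℕ) : xiZero c' D j 0 d r = 0 := by
  unfold xiZero; simp

end Literature.NumberTheory.LFunctions.Zhang2022.Lemma83

end
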